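import Summits.ValiantsHypothesis.ValiantsHypothesis.Theorems.BinomialElusivePeelingLemmaGadget
import Summits.ValiantsHypothesis.ValiantsHypothesis.Theorems.BinomialElusivePeelingLemmaGadgetSymDefs

/-!
# The theta gadget with symmetric closing, I: injective arms, where letters are born

Helper for the crux stmt-ValiantsHypothesis-7391 (negative lane; `Cruxes/PeelingLemma/DETERMINISTIC-ALLX.md`
§3d TODO(3)): the same statements as `BinomialElusivePeelingLemmaGadget.lean` for the birth sequences
`birth2 q no j` with the SYMMETRIC closing order `closing2` (odd closing birth `2k+1` = `beta' (armAge q j (2k))`),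
so that the vicinity of `b'`, read backwards, has the combinatorics of the vicinity of `b`:
`birth2_injective`, `birth2_eq_ord_iff`, `birth2_eq_ex_iff`, `birth2_eq_beta`, `birth2_eq_beta'`.  No Theses import.
-/

namespace Summit.ValiantsHypothesis.ValiantsHypothesis.Theorems.PeelingLemmaGadget

-- summit = sub-problem name (single-conjunct summit, D-0017 layout), so the namespace repeats it
set_option linter.dupNamespace false

open scoped BigOperators
open Finset
open Summit.ValiantsHypothesis.ValiantsHypothesis.Theorems.PeelingLemmaWindow (win)

variable {q no : ℕ}

/-- At nonnegative positions `birth` is `birthNat2`. -/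
theorem birth2_of_nonneg (j : Fin 5) {t : ℤ} (ht : 0 ≤ t) :
    birth2 q no j t = birthNat2 q no j t.toNat := by
  unfold birth2; rw [if_neg (not_lt.mpr ht)]

/-- `birth` at a natural position. -/
theorem birth2_natCast (j : Fin 5) (n : ℕ) : birth2 q no j (n : ℤ) = birthNat2 q no j n := by
  rw [birth2_of_nonneg j (Int.natCast_nonneg n), Int.toNat_natCast]

/-- Positions `0..2q`: the `beta` letters (in the arm's age order). -/
theorem birthNat2_beta (j : Fin 5) {n : ℕ} (hn : n ≤ 2 * q) :
    birthNat2 q no j n = GLetter.beta (armAge q j ⟨2 * q - n, by omega⟩) := by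
  unfold birthNat2; rw [dif_pos hn]

/-- Positions `2q+1..2q+no`: the ordinary births. -/
theorem birthNat2_ord (j : Fin 5) {n : ℕ} (h1 : 2 * q < n) (h2 : n ≤ 2 * q + no) :
    birthNat2 q no j n = GLetter.ord j ⟨n - (2 * q + 1), by omega⟩ := by
  unfold birthNat2; rw [dif_neg (by omega), dif_pos h2]

/-- Position `2q+no+1`: the extra closing letter. -/
theorem birthNat2_ex (j : Fin 5) : birthNat2 q no j (2 * q + no + 1) = GLetter.ex j := by
  unfold birthNat2; rw [dif_neg (by omega), dif_neg (by omega), if_pos rfl]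

/-- Positions `2q+no+2..4q+no+1`: the closing births. -/
theorem birthNat2_closing (j : Fin 5) {n : ℕ} (h1 : 2 * q + no + 1 < n) (h2 : n ≤ 4 * q + no + 1) :
    birthNat2 q no j n = closing2 q no j (n - (2 * q + no + 1)) := by
  unfold birthNat2; rw [dif_neg (by omega), dif_neg (by omega), if_neg (by omega), if_pos h2]

/-- Position `4q+no+2` (`= b'`): the kept letter. -/
theorem birthNat2_kept (j : Fin 5) : birthNat2 q no j (4 * q + no + 2) = GLetter.beta' (evenAge q j) := by
  unfold birthNat2
  rw [dif_neg (by omega), dif_neg (by omega), if_neg (by omega), if_neg (by omega), if_pos rfl]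

/-- Beyond `b'`: junk. -/
theorem birthNat2_junk (j : Fin 5) {n : ℕ} (h : 4 * q + no + 2 < n) :
    birthNat2 q no j n = GLetter.junk n := by
  unfold birthNat2
  rw [dif_neg (by omega), dif_neg (by omega), if_neg (by omega), if_neg (by omega), if_neg (by omega)]

/-- The image under `armAge` of an age other than `2q` is never `evenAge`. -/
theorem armAge_ne_evenAge (j : Fin 5) (a : Fin (2 * q + 1)) (ha : (a : ℕ) ≠ 2 * q) :
    armAge q j a ≠ evenAge q j := by
  intro h
  unfold armAge at h
  rcases eq_or_ne a (topAge q) with h1 | h1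
  · exact ha (by rw [h1]; rfl)
  rcases eq_or_ne a (evenAge q j) with h2 | h2
  · rw [h2, Equiv.swap_apply_right] at h
    have := congrArg Fin.val h; simp only [topAge, evenAge] at this; omega
  · rw [Equiv.swap_apply_of_ne_of_ne h1 h2] at h; exact h2 h

/-- Symmetric closing letters are `beta'` letters other than the kept one, of the right parity. -/
theorem closing2_eq_beta' (j : Fin 5) {i : ℕ} (h1 : 1 ≤ i) (h2 : i ≤ 2 * q) :
    ∃ a : Fin (2 * q + 1), closing2 q no j i = GLetter.beta' a ∧ a ≠ evenAge q j ∧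
      (a : ℕ) % 2 = (i + 1) % 2 := by
  unfold closing2
  by_cases hi : i % 2 = 0
  · refine ⟨⟨min (i - 1) (2 * q), by omega⟩, by rw [if_pos hi], ?_, ?_⟩
    · intro h; have := congrArg Fin.val h; have := evenAge_even q j; simp only at *; omega
    · simp only; omega
  · refine ⟨armAge q j ⟨min (i - 1) (2 * q), by omega⟩, by rw [if_neg hi],
      armAge_ne_evenAge j _ (by simp only; omega), ?_⟩
    rw [armAge_parity]; simp only; omega

/-- Classification of the values of `birthNat2` by position. -/
theorem birthNat2_shape (j : Fin 5) (n : ℕ) :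
    (n ≤ 2 * q ∧ ∃ a, birthNat2 q no j n = GLetter.beta a) ∨
    (2 * q < n ∧ n ≤ 2 * q + no ∧ ∃ k : Fin no, (k : ℕ) = n - (2 * q + 1) ∧
        birthNat2 q no j n = GLetter.ord j k) ∨
    (n = 2 * q + no + 1 ∧ birthNat2 q no j n = GLetter.ex j) ∨
    (2 * q + no + 2 ≤ n ∧ n ≤ 4 * q + no + 2 ∧ ∃ a, birthNat2 q no j n = GLetter.beta' a) ∨
    (4 * q + no + 2 < n ∧ birthNat2 q no j n = GLetter.junk n) := by
  by_cases h1 : n ≤ 2 * q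
  · exact Or.inl ⟨h1, _, birthNat2_beta j h1⟩
  by_cases h2 : n ≤ 2 * q + no
  · exact Or.inr (Or.inl ⟨by omega, h2, ⟨n - (2 * q + 1), by omega⟩, rfl, birthNat2_ord j (by omega) h2⟩)
  by_cases h3 : n = 2 * q + no + 1
  · exact Or.inr (Or.inr (Or.inl ⟨h3, by rw [h3, birthNat2_ex]⟩))
  by_cases h4 : n ≤ 4 * q + no + 1
  · obtain ⟨a, ha, -, -⟩ := closing2_eq_beta' (q := q) (no := no) j
      (i := n - (2 * q + no + 1)) (by omega) (by omega)
    exact Or.inr (Or.inr (Or.inr (Or.inl ⟨by omega, by omega, a,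
      by rw [birthNat2_closing j (by omega) h4, ha]⟩)))
  by_cases h5 : n = 4 * q + no + 2
  · exact Or.inr (Or.inr (Or.inr (Or.inl ⟨by omega, by omega, _, by rw [h5, birthNat2_kept]⟩)))
  · exact Or.inr (Or.inr (Or.inr (Or.inr ⟨by omega, birthNat2_junk j (by omega)⟩)))

/-! ## Injectivity of the birth sequence (a left inverse) -/

/-- `birthNat2` has a left inverse; in particular it is injective. -/
theorem exists_leftInverse_birthNat2 (j : Fin 5) :
    ∃ pos : GLetter q no → ℕ, ∀ n, pos (birthNat2 q no j n) = n := by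
  classical
  let e : ℕ := (evenAge q j : ℕ)
  refine ⟨fun L => match L with
    | GLetter.beta a => 2 * q - ((armAge q j a : Fin (2 * q + 1)) : ℕ)
    | GLetter.ord _ k => 2 * q + 1 + (k : ℕ)
    | GLetter.ex _ => 2 * q + no + 1
    | GLetter.beta' a =>
        if (a : ℕ) = e then 4 * q + no + 2 else 2 * q + no + 2 + ((armAge q j a : Fin (2 * q + 1)) : ℕ)
    | GLetter.junk z => z.toNat, fun n => ?_⟩
  by_cases h1 : n ≤ 2 * q
  · rw [birthNat2_beta j h1]
    simp only [armAge, Equiv.swap_apply_self]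
    omega
  by_cases h2 : n ≤ 2 * q + no
  · rw [birthNat2_ord j (by omega) h2]; simp only; omega
  by_cases h3 : n = 2 * q + no + 1
  · subst h3; rw [birthNat2_ex]
  by_cases h4 : n ≤ 4 * q + no + 1
  · rw [birthNat2_closing j (by omega) h4]
    unfold closing2
    have hee := evenAge_even q j
    by_cases hpar : (n - (2 * q + no + 1)) % 2 = 0
    · rw [if_pos hpar]
      simp only
      have hodd : ¬ ((⟨min (n - (2 * q + no + 1) - 1) (2 * q), by omega⟩ : Fin (2 * q + 1)) =
          topAge q) := by
        intro h; have := congrArg Fin.val h; simp only [topAge] at this; omega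
      have hodd' : ¬ ((⟨min (n - (2 * q + no + 1) - 1) (2 * q), by omega⟩ : Fin (2 * q + 1)) =
          evenAge q j) := by
        intro h; have := congrArg Fin.val h; simp only [evenAge] at this; omega
      rw [if_neg (by simp only [e]; omega)]
      simp only [armAge, Equiv.swap_apply_of_ne_of_ne hodd hodd']
      omega
    · rw [if_neg hpar]
      have hne := armAge_ne_evenAge (q := q) j ⟨min (n - (2 * q + no + 1) - 1) (2 * q), by omega⟩
        (by simp only; omega)
      simp only
      rw [if_neg (fun h => hne (Fin.ext h))]
      simp only [armAge, Equiv.swap_apply_self]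
      omega
  by_cases h5 : n = 4 * q + no + 2
  · subst h5; rw [birthNat2_kept]; simp [e]
  · rw [birthNat2_junk j (by omega)]; simp

/-- The birth sequence of an arm is injective (blueprint §3: "arms are injective birth sequences"). -/
theorem birth2_injective (j : Fin 5) : Function.Injective (birth2 q no j) := by
  obtain ⟨pos, hpos⟩ := exists_leftInverse_birthNat2 (q := q) (no := no) j
  -- integer-valued left inverse
  let posZ : GLetter q no → ℤ := fun L => match L with
    | GLetter.junk z => z
    | L => (pos L : ℤ)
  have hleft : ∀ t, posZ (birth2 q no j t) = t := by
    intro t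
    by_cases ht : t < 0
    · simp only [birth2, if_pos ht, posZ]
    · rw [birth2_of_nonneg j (not_lt.mp ht)]
      have hn := hpos t.toNat
      have ht0 : ((t.toNat : ℕ) : ℤ) = t := Int.toNat_of_nonneg (not_lt.mp ht)
      -- is the value a junk letter?
      by_cases hj : 4 * q + no + 2 < t.toNat
      · rw [birthNat2_junk j hj]; simp only [posZ]; exact ht0
      · have hval : ∀ L : GLetter q no, (∀ z, L ≠ GLetter.junk z) → posZ L = (pos L : ℤ) := by
          intro L hL; cases L <;> simp only [posZ] ; exact absurd rfl (hL _)
        rw [hval _ ?_, hn, ht0]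
        intro z
        rcases birthNat2_shape (q := q) (no := no) j t.toNat with
          ⟨-, a, hb⟩ | ⟨-, -, k, -, hb⟩ | ⟨-, hb⟩ | ⟨-, -, a, hb⟩ | ⟨h5, -⟩
        all_goals first | omega | (rw [hb]; intro h; cases h)
  intro t t' h
  have := congrArg posZ h
  rwa [hleft, hleft] at this

/-- Classification of the values of `birth` by (integer) position. -/
theorem birth2_shape (j : Fin 5) (t : ℤ) :
    (∃ z, birth2 q no j t = GLetter.junk z) ∨
    (0 ≤ t ∧ t ≤ 2 * q ∧ ∃ a, birth2 q no j t = GLetter.beta a) ∨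
    ((2 * q : ℤ) < t ∧ t ≤ 2 * q + no ∧ ∃ k : Fin no, (k : ℤ) = t - (2 * q + 1) ∧
        birth2 q no j t = GLetter.ord j k) ∨
    (t = 2 * q + no + 1 ∧ birth2 q no j t = GLetter.ex j) ∨
    ((2 * q + no + 2 : ℤ) ≤ t ∧ t ≤ 4 * q + no + 2 ∧ ∃ a, birth2 q no j t = GLetter.beta' a) := by
  by_cases ht : t < 0
  · exact Or.inl ⟨t, by simp only [birth2, if_pos ht]⟩
  rw [birth2_of_nonneg j (not_lt.mp ht)]
  have ht0 : ((t.toNat : ℕ) : ℤ) = t := Int.toNat_of_nonneg (not_lt.mp ht)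
  rcases birthNat2_shape (q := q) (no := no) j t.toNat with
    ⟨h1, a, ha⟩ | ⟨h1, h2, k, hk, hb⟩ | ⟨h1, hb⟩ | ⟨h1, h2, a, ha⟩ | ⟨-, hb⟩
  · exact Or.inr (Or.inl ⟨by omega, by omega, a, ha⟩)
  · exact Or.inr (Or.inr (Or.inl ⟨by omega, by omega, k, by omega, hb⟩))
  · exact Or.inr (Or.inr (Or.inr (Or.inl ⟨by omega, hb⟩)))
  · exact Or.inr (Or.inr (Or.inr (Or.inr ⟨by omega, by omega, a, ha⟩)))
  · exact Or.inl ⟨_, hb⟩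

/-- Ordinary letters are private: `ord j k` is born only on arm `j`, at position `2q + 1 + k`. -/
theorem birth2_eq_ord_iff (j j' : Fin 5) (t : ℤ) (k : Fin no) :
    birth2 q no j t = GLetter.ord j' k ↔ j = j' ∧ t = 2 * q + 1 + (k : ℕ) := by
  constructor
  · intro h
    rcases birth2_shape (q := q) (no := no) j t with
      ⟨z, hb⟩ | ⟨-, -, a, hb⟩ | ⟨-, -, k', hk', hb⟩ | ⟨-, hb⟩ | ⟨-, -, a, hb⟩ <;> rw [hb] at h <;> cases h
    exact ⟨rfl, by omega⟩
  · rintro ⟨rfl, rfl⟩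
    rw [show (2 * q + 1 + (k : ℕ) : ℤ) = ((2 * q + 1 + (k : ℕ) : ℕ) : ℤ) by push_cast; ring,
      birth2_natCast, birthNat2_ord j (by omega) (by omega)]
    congr 1; exact Fin.ext (by simp)

/-- Extra letters are private: `ex j` is born only on arm `j`, at position `2q + no + 1`. -/
theorem birth2_eq_ex_iff (j j' : Fin 5) (t : ℤ) :
    birth2 q no j t = GLetter.ex j' ↔ j = j' ∧ t = 2 * q + no + 1 := by
  constructor
  · intro h
    rcases birth2_shape (q := q) (no := no) j t with
      ⟨z, hb⟩ | ⟨-, -, a, hb⟩ | ⟨-, -, k', -, hb⟩ | ⟨h1, hb⟩ | ⟨-, -, a, hb⟩ <;> rw [hb] at h <;> cases h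
    exact ⟨rfl, h1⟩
  · rintro ⟨rfl, rfl⟩
    rw [show (2 * q + no + 1 : ℤ) = ((2 * q + no + 1 : ℕ) : ℤ) by push_cast; ring, birth2_natCast,
      birthNat2_ex]

/-- `beta` letters are born only in the initial segment `[0, 2q]` (they are the letters of `b`). -/
theorem birth2_eq_beta (j : Fin 5) (t : ℤ) (a : Fin (2 * q + 1)) (h : birth2 q no j t = GLetter.beta a) :
    0 ≤ t ∧ t ≤ 2 * q := by
  rcases birth2_shape (q := q) (no := no) j t with
    ⟨z, hb⟩ | ⟨h1, h2, -, -⟩ | ⟨-, -, k', -, hb⟩ | ⟨-, hb⟩ | ⟨-, -, a', hb⟩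
  all_goals first | exact ⟨h1, h2⟩ | (rw [hb] at h; cases h)

/-- `beta'` letters are born only in the closing segment `[2q+no+2, 4q+no+2]` (letters of `b'`). -/
theorem birth2_eq_beta' (j : Fin 5) (t : ℤ) (a : Fin (2 * q + 1))
    (h : birth2 q no j t = GLetter.beta' a) : 2 * q + no + 2 ≤ t ∧ t ≤ 4 * q + no + 2 := by
  rcases birth2_shape (q := q) (no := no) j t with
    ⟨z, hb⟩ | ⟨-, -, a', hb⟩ | ⟨-, -, k', -, hb⟩ | ⟨-, hb⟩ | ⟨h1, h2, -, -⟩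
  all_goals first | exact ⟨h1, h2⟩ | (rw [hb] at h; cases h)

end Summit.ValiantsHypothesis.ValiantsHypothesis.Theorems.PeelingLemmaGadget
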